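import Summits.HodgeConjecture.HodgeConjecture.Theorems.HeckePrymWeilHyperbolicEightfoldsSqrtMinus7AbstractSwitch
import Summits.HodgeConjecture.HodgeConjecture.Theorems.HeckePrymWeilHyperbolicEightfoldsSqrtMinus7SwitchTransfer
import Summits.HodgeConjecture.HodgeConjecture.Theorems.HeckePrymWeilHyperbolicEightfoldsSqrtMinus7EndAdditiveH1
import Summits.HodgeConjecture.HodgeConjecture.Theorems.HeckePrymWeilHyperbolicEightfoldsSqrtMinus7SchoenDicyclic
import Summits.HodgeConjecture.HodgeConjecture.Theorems.HeckePrymWeilHyperbolicEightfoldsSqrtMinus7DicyclicAlgebra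
import Literature.AlgebraicGeometry.HodgeTheory.WeilClassesCyclicPrym
import Literature.AlgebraicGeometry.Motives.AbelianVarietyCohomologyExteriorH1
import HarnessLib

/-!
# Anchor-fibre algebraicity for the dicyclic quaternion switch

Support file for crux `HeckePrymWeil.HyperbolicEightfoldsSqrtMinus7` (item stmt-HodgeConjecture-14642, route
route-HodgeConjecture-HeckePrymWeil), line `Sketch` (idea `dicyclic-quaternion-switch`, skeleton
`Cruxes/HyperbolicEightfoldsSqrtMinus7/Lines/Sketch.lean`), registered sub-goal
`weilPlane_algebraic_of_isogenous_dicyclic` (lead `prover-line-stmt-HodgeConjecture-14642-1`, cycle 2, 2026-08-16).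

CONTENT.  GIVEN Schoen's cyclic theorem at degree 6 (Literature named fact
`HodgeTheory.Schoen1988_cyclicPrym_weilClasses_algebraic_degreeSix`, Schoen 1988 Cor. 3.1 = Patel–Zhang 2025 Thm 5.3),
the typed `√-7`-Weil plane `Eig((𝟙+φ_Y)^*, (1+i√7)⁸) ⊔ Eig((𝟙+φ_Y)^*, (1-i√7)⁸)` is ALGEBRAIC on every complex
abelian eightfold `(Y, φ_Y)` (`φ_Y² = -7`) that carries a `φ`-EQUIVARIANT ISOGENY PAIR `u : Y ⟶ B`, `v : B ⟶ Y`
(`u ≫ v = k`, `v ≫ u = k`, `u ≫ φ₀ = φ_Y ≫ u`, `v ≫ φ_Y = φ₀ ≫ v`) towards the DICYCLIC ANCHOR `(B, φ₀)`: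
`B = (ker Φ₆(α_*))⁰ ⊂ J(C)` for a genus-25 curve `C` with a free `Dic₃`-action `⟨α, ξ⟩` (`α⁶ = 𝟙`, `ξ² = α³`,
`αξα = ξ`), `φ₀ = 𝟙 + 2ξ_*|_B + 2(α_*|_B)²`.  This is the anchor half of the line (everything except PEL reach
and transport), assembled from PROVED tree results: the dicyclic relations `φ₀² = -7`, `φ₀ψ₀ + ψ₀φ₀ = -6` for
`ψ₀ = 𝟙 + 2(α_*|_B)²` (`stub_dicyclicAlgebra`, p96599), `ψ₀² = -3` (`kerComponent_weilOperator_comp_self`), the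
transported `√-3` `ψ_Y := u ≫ ψ₀ ≫ v` (`ψ_Y² = -3k²`, anticommutator `-6k` with `φ_Y`, `36k² < 84k²`,
`ℚ(√-3)`-equivariance of `(u, v)` — the bookkeeping lemmas `transported_*` below), Schoen + isogeny invariance
(`stub_schoenDicyclic_of_schoen`, p90404, fed with `H• = ⋀•H¹` — the tree's DISCHARGED
`abelianVarietyCohomologyExteriorH1_holds` — and additivity of pull-back on `H¹`, `stub_endAdditiveH1`, p90289), and
the quaternion field switch (`stub_abstractSwitch` p92596, `stub_switchTransfer` p90051).  CONSEQUENCE for the skeleton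
(v4, `stub_pelReach`): the reach stub need only deliver a `φ`-equivariant isogeny pair towards the anchor fibre; the
`ℚ(√-3)`-structure `(ψ_Y, m, t)` it currently posits is derivable.  CONDITIONAL on the named fact only.

## References
[Schoen1988HodgeWeil] Compositio Math. 65 (1988), Cor. 3.1; [PatelZhang2025PrymHodge] arXiv:2506.13729, Thm 5.3;
[vanGeemen1994HodgeAV] LNM 1594, 3.6–3.7 (isogeny invariance).
-/

noncomputable section
-- every declaration of this problem lives in Summit.HodgeConjecture.HodgeConjecture.… (summit = problem)
set_option linter.dupNamespace false

open CategoryTheory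
open Literature.AlgebraicGeometry Literature.AlgebraicGeometry.Motives
  Literature.AlgebraicGeometry.HodgeTheory Literature.AlgebraicTopology.SingularHomology

namespace Summit.HodgeConjecture.HodgeConjecture.Theorems.HyperbolicEightfoldsSqrtMinus7.DicyclicQuaternionSwitch

section IsogenyBookkeeping

variable {Y B : AbelianVariety ℂ}

/-- `ψ_Y := u ≫ ψ₀ ≫ v` squares to `-3k²` when `ψ₀² = -3`, `u ≫ v = k`, `v ≫ u = k`. [bookkeeping] -/
theorem transported_sq (u : Y ⟶ B) (v : B ⟶ Y) (ψ₀ : B ⟶ B) (k : ℕ)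
    (huv : u ≫ v = (k : ℤ) • 𝟙 Y) (hvu : v ≫ u = (k : ℤ) • 𝟙 B)
    (hψ₀ : ψ₀ ≫ ψ₀ = (-3 : ℤ) • 𝟙 B) :
    (u ≫ ψ₀ ≫ v) ≫ (u ≫ ψ₀ ≫ v) = -((3 * (k : ℤ) ^ 2) • 𝟙 Y) := by
  have h1 : (u ≫ ψ₀ ≫ v) ≫ (u ≫ ψ₀ ≫ v) = u ≫ ψ₀ ≫ (v ≫ u) ≫ ψ₀ ≫ v := by
    simp only [Category.assoc]
  rw [h1, hvu, Preadditive.zsmul_comp, Category.id_comp, Preadditive.comp_zsmul,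
    ← Category.assoc ψ₀ ψ₀ v, hψ₀, Preadditive.zsmul_comp, Category.id_comp,
    Preadditive.comp_zsmul, Preadditive.comp_zsmul, huv, smul_smul, smul_smul, ← neg_zsmul]
  congr 1
  ring

/-- The anticommutator of `φ_Y` with `ψ_Y := u ≫ ψ₀ ≫ v` is `-6k` when `φ_Bψ₀ + ψ₀φ_B = -6` and `(u, v)` is
a `φ`-equivariant isogeny pair with `u ≫ v = k`. [bookkeeping] -/
theorem transported_anticomm (u : Y ⟶ B) (v : B ⟶ Y) (ψ₀ φB : B ⟶ B) (φY : Y ⟶ Y) (k : ℕ)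
    (huv : u ≫ v = (k : ℤ) • 𝟙 Y) (huφ : u ≫ φB = φY ≫ u) (hvφ : v ≫ φY = φB ≫ v)
    (hanti : φB ≫ ψ₀ + ψ₀ ≫ φB = (-6 : ℤ) • 𝟙 B) :
    φY ≫ (u ≫ ψ₀ ≫ v) + (u ≫ ψ₀ ≫ v) ≫ φY = (-6 * (k : ℤ)) • 𝟙 Y := by
  have h1 : φY ≫ (u ≫ ψ₀ ≫ v) = u ≫ (φB ≫ ψ₀) ≫ v := by
    rw [← Category.assoc, ← huφ]; simp only [Category.assoc]
  have h2 : (u ≫ ψ₀ ≫ v) ≫ φY = u ≫ (ψ₀ ≫ φB) ≫ v := by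
    simp only [Category.assoc]; rw [hvφ]
  rw [h1, h2, ← Preadditive.comp_add, ← Preadditive.add_comp, hanti, Preadditive.zsmul_comp,
    Category.id_comp, Preadditive.comp_zsmul, huv, smul_smul]

/-- `v ≫ ψ_Y = (k·ψ₀) ≫ v` for `ψ_Y := u ≫ ψ₀ ≫ v`, `v ≫ u = k`. [bookkeeping] -/
theorem transported_equivariant_left (u : Y ⟶ B) (v : B ⟶ Y) (ψ₀ : B ⟶ B) (k : ℕ)
    (hvu : v ≫ u = (k : ℤ) • 𝟙 B) :
    v ≫ (u ≫ ψ₀ ≫ v) = ((k : ℤ) • ψ₀) ≫ v := by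
  rw [← Category.assoc, hvu]
  simp only [Preadditive.zsmul_comp, Category.id_comp]

/-- `u ≫ (k·ψ₀) = ψ_Y ≫ u` for `ψ_Y := u ≫ ψ₀ ≫ v`, `v ≫ u = k`. [bookkeeping] -/
theorem transported_equivariant_right (u : Y ⟶ B) (v : B ⟶ Y) (ψ₀ : B ⟶ B) (k : ℕ)
    (hvu : v ≫ u = (k : ℤ) • 𝟙 B) :
    u ≫ ((k : ℤ) • ψ₀) = (u ≫ ψ₀ ≫ v) ≫ u := by
  simp only [Category.assoc]
  rw [hvu]
  simp only [Preadditive.comp_zsmul, Category.comp_id]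

/-- `t² < 84m²` for `t = -6k`, `m = k ≥ 1` (`36 < 84`). [bookkeeping] -/
theorem anticomm_bound (k : ℕ) (hk : 0 < k) : (-6 * (k : ℤ)) ^ 2 < 84 * (k : ℤ) ^ 2 := by
  have hk' : (0 : ℤ) < k := by exact_mod_cast hk
  nlinarith

end IsogenyBookkeeping

/-- **Anchor-fibre algebraicity: the typed `φ_Y`-Weil plane is algebraic on every `(Y, φ_Y)` that is
`φ`-equivariantly isogenous to the dicyclic anchor `(B, φ₀)` — GIVEN Schoen's cyclic theorem.**  DATUM: a dicyclic
datum `(C, 𝒥, α, ξ)` (`α⁶ = 𝟙`, `ξ² = α³`, `αξα = ξ`, `α²`, `α³` fixed-point free, `dim 𝒥 = 25`), `s = α_*`,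
`x = ξ_*`, `B = (ker Φ₆(s))⁰` with restrictions `s_B`, `x_B`, `ψ₀ = 𝟙 + 2s_B²`, `φ₀ = 𝟙 + 2x_B + 2s_B²`; an abelian
eightfold `Y` with `φ_Y² = -7` and a `φ`-equivariant isogeny pair `u : Y ⟶ B` (flat), `v : B ⟶ Y`, `u ≫ v = k`,
`v ≫ u = k` (`k ≥ 1`).  CLAIM: every class of `Eig((𝟙+φ_Y)^*, (1+i√7)⁸) ⊔ Eig((𝟙+φ_Y)^*, (1-i√7)⁸) ⊆ H⁸(Y(ℂ); ℂ)` is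
algebraic.  PROOF: `φ₀² = -7`, `φ₀ψ₀ + ψ₀φ₀ = -6` (`stub_dicyclicAlgebra`, p96599), `ψ₀² = -3`
(`kerComponent_weilOperator_comp_self`); `ψ_Y := u ≫ ψ₀ ≫ v` has `ψ_Y² = -3k²`, `φ_Yψ_Y + ψ_Yφ_Y = -6k`, `36k² < 84k²`,
and `(u, v)` is `ℚ(√-3)`-equivariant for `(ψ_Y, k·ψ₀)`; Schoen + isogeny invariance (`stub_schoenDicyclic_of_schoen`,
p90404, fed with `H• = ⋀•H¹` — the tree's discharge `abelianVarietyCohomologyExteriorH1_holds` — and `stub_endAdditiveH1`,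
p90289) make the typed `ψ_Y`-plane algebraic, and the quaternion field switch (`stub_switchTransfer` p90051 ∘
`stub_abstractSwitch` p92596) the typed `φ_Y`-plane.  CONDITIONAL on the named fact `hSchoen` only.  USE (for the
skeleton's `stub_pelReach`, v4 of lead c1-0): the PEL reach need only deliver a `φ`-EQUIVARIANT ISOGENY PAIR towards the
anchor — `ψ_Y`, `m = k`, `t = -6k` and the `ℚ(√-3)`-equivariance are derived here, not posited. -/
theorem weilPlane_algebraic_of_isogenous_dicyclic :
    Schoen1988_cyclicPrym_weilClasses_algebraic_degreeSix →
    ∀ (C : SchemeOver ℂ) (𝒥 : Jacobian C) (α ξ : C ⟶ C),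
      IsSmoothProjective 1 C → 𝒥.J.dim = 25 →
      α ≫ α ≫ α ≫ α ≫ α ≫ α = 𝟙 C → ξ ≫ ξ = α ≫ α ≫ α → α ≫ ξ ≫ α = ξ →
      (∀ P : ComplexPoints C, P ≫ (α ≫ α) ≠ P ∧ P ≫ (α ≫ α ≫ α) ≠ P) →
    ∀ (s x : 𝒥.J ⟶ 𝒥.J), s = 𝒥.pushforward 𝒥 α → x = 𝒥.pushforward 𝒥 ξ →
    ∀ (sB xB ψ₀ φ₀ : AbelianVariety.kerComponent (𝟙 𝒥.J - s + s ≫ s) ⟶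
        AbelianVariety.kerComponent (𝟙 𝒥.J - s + s ≫ s)),
      sB ≫ AbelianVariety.kerComponentι (𝟙 𝒥.J - s + s ≫ s) =
        AbelianVariety.kerComponentι (𝟙 𝒥.J - s + s ≫ s) ≫ s →
      xB ≫ AbelianVariety.kerComponentι (𝟙 𝒥.J - s + s ≫ s) =
        AbelianVariety.kerComponentι (𝟙 𝒥.J - s + s ≫ s) ≫ x →
      ψ₀ = 𝟙 _ + 2 • (sB ≫ sB) → φ₀ = 𝟙 _ + 2 • xB + 2 • (sB ≫ sB) →
    ∀ (Y : AbelianVariety ℂ) (φY : Y ⟶ Y)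
      (u : Y ⟶ AbelianVariety.kerComponent (𝟙 𝒥.J - s + s ≫ s))
      (v : AbelianVariety.kerComponent (𝟙 𝒥.J - s + s ≫ s) ⟶ Y) (k : ℕ),
      Y.dim = 8 → 0 < k → φY ≫ φY = -((7 : ℤ) • 𝟙 Y) → AlgebraicGeometry.Flat u.hom.hom.hom.left →
      u ≫ v = (k : ℤ) • 𝟙 Y → v ≫ u = (k : ℤ) • 𝟙 _ → u ≫ φ₀ = φY ≫ u → v ≫ φY = φ₀ ≫ v →
    ∀ c : complexBetti Y.X 8,
      c ∈ Module.End.eigenspace (complexBetti.map (𝟙 Y + φY).hom.hom.hom 8).hom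
            ((1 + Complex.I * (Real.sqrt (7 : ℝ) : ℂ)) ^ 8) ⊔
          Module.End.eigenspace (complexBetti.map (𝟙 Y + φY).hom.hom.hom 8).hom
            ((1 - Complex.I * (Real.sqrt (7 : ℝ) : ℂ)) ^ 8) →
      c ∈ algebraicClasses Y.X 4 := by
  intro hSchoen C 𝒥 α ξ hC hg25 hα6 hξ2 hrel hfree s x hs hx sB xB ψ₀ φ₀ hsB hxB hψ₀ hφ₀ Y φY u v k hY hk hφY
    hflat huv hvu huφ hvφ
  -- `H• = ⋀•H¹`, `dim H¹ = 2 dim A`: the tree's discharge of the named fact (Hopf's theorem for `A(ℂ)`)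
  have hExt : ∀ A : AbelianVariety ℂ,
      HasExteriorCohomologyH1 ℂ (ComplexPoints A.X) ∧ Module.finrank ℂ (complexBetti A.X 1) = 2 * A.dim :=
    fun A => ⟨(abelianVarietyCohomologyExteriorH1_holds A).2.2, (abelianVarietyCohomologyExteriorH1_holds A).2.1⟩
  obtain ⟨hφ₀sq, hanti₀⟩ :=
    stub_dicyclicAlgebra C 𝒥 α ξ hα6 hξ2 hrel s x hs hx sB xB ψ₀ φ₀ hsB hxB hψ₀ hφ₀
  have hψ₀sq : ψ₀ ≫ ψ₀ = (-3 : ℤ) • 𝟙 _ := kerComponent_weilOperator_comp_self hsB hψ₀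
  -- the transported `√-3`: `ψ_Y := u ≫ ψ₀ ≫ v`
  have hψY : (u ≫ ψ₀ ≫ v) ≫ (u ≫ ψ₀ ≫ v) = -((3 * (k : ℤ) ^ 2) • 𝟙 Y) :=
    transported_sq u v ψ₀ k huv hvu hψ₀sq
  have hanti : φY ≫ (u ≫ ψ₀ ≫ v) + (u ≫ ψ₀ ≫ v) ≫ φY = (-6 * (k : ℤ)) • 𝟙 Y :=
    transported_anticomm u v ψ₀ φ₀ φY k huv huφ hvφ hanti₀
  have ht : (-6 * (k : ℤ)) ^ 2 < 84 * (k : ℤ) ^ 2 := anticomm_bound k hk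
  -- Schoen on the dicyclic datum + isogeny invariance: the typed `ψ_Y`-plane of `Y` is algebraic
  have hψalg := stub_schoenDicyclic_of_schoen hSchoen hExt stub_endAdditiveH1 C 𝒥 α ξ hC hg25 hα6
    hξ2 hrel hfree s x hs hx sB xB ψ₀ hsB hxB hψ₀ Y (u ≫ ψ₀ ≫ v) k k u v hk hk hflat huv
    (transported_equivariant_left u v ψ₀ k hvu) (transported_equivariant_right u v ψ₀ k hvu)
  -- the switch: the typed `φ_Y`-plane of `Y` is algebraic
  exact stub_switchTransfer stub_abstractSwitch hExt stub_endAdditiveH1 Y φY (u ≫ ψ₀ ≫ v) k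
    (-6 * (k : ℤ)) hY hk hφY hψY hanti ht hψalg

end Summit.HodgeConjecture.HodgeConjecture.Theorems.HyperbolicEightfoldsSqrtMinus7.DicyclicQuaternionSwitch
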